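import Mathlib.Analysis.Normed.Module.Dual
import Literature.Analysis.FunctionSpaces.TorusLerayHelmholtzProofs
import Literature.Analysis.FunctionSpaces.TorusRieszFischerParam
import HarnessLib

/-!
# Fourier synthesis on the flat torus: smooth functions from rapidly decaying coefficients

Analysis/FunctionSpaces support file. For a coefficient family `c : ℤ^d → V` (values in a
complex Banach space) of **rapid decay** — `∑_k (1 + |k|²)^m ‖c k‖ < ∞` for every `m` — the
Fourier series `F_c(x) = ∑_k e_k(x) c_k`, `e_k(x) = e^{2πi k·x}` (`UnitAddTorus.mFourier`), defines
a smooth function on `T^d = UnitAddTorus d` (in the tree: `Torus.isSmooth_tsum_mFourier_smul`)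
whose partial derivatives are the series with coefficients `2πi kⱼ c_k`, and every smooth
`V`-valued function is the synthesis of its own (rapidly decaying) coefficients (Grafakos 2014, Ch. 3:
Prop. 3.1.2 (10) `𝓕(∂^α f)(m) = (2πi m)^α 𝓕f(m)`, Thm. 3.3.9 decay of the coefficients of smooth
functions, §3.3.3 absolutely convergent Fourier series, Prop. 3.2.4 uniqueness and Prop. 3.2.5
Fourier inversion).
This is the calculus behind Fourier-multiplier operators on `C^∞(T^d)` (inverse Laplacian, Leray
projector, inverse divergence, Biot–Savart), developed in a follow-up file.

## Contents (all proved)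

* `Torus.RapidDecay c` and its algebra (`add`, `const_smul`, domination by symbols of
  polynomial growth `RapidDecay.of_norm_le_mul_pow`, derivative symbols `RapidDecay.deriv`).
* `Torus.fourierSynth c x = ∑' k, mFourier k x • c k`, a name for the synthesised series; its
  convergence, smoothness, continuity and coefficients for rapidly decaying `c` are the existing
  `Torus.hasSum_mFourier_smul`, `Torus.isSmooth_tsum_mFourier_smul`,
  `Torus.continuous_tsum_mFourier_smul`, `Torus.mFourierCoeff_tsum_mFourier_smul` of
  `TorusLerayHelmholtzProofs` (restated as one-line corollaries `RapidDecay.*_fourierSynth`);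
  new here is `∂ⱼ (fourierSynth c) = fourierSynth (2πi kⱼ • c)`
  (`RapidDecay.partialDeriv_fourierSynth`, termwise differentiation along coordinate lines).
* Smooth `V`-valued functions have rapidly decaying coefficients
  (`IsSmooth.rapidDecay_mFourierCoeff`, by `(1 + |k|²)^m 𝓕f(k) = 𝓕((1 - Δ/4π²)^m f)(k)` with the
  named operator `Torus.oneSubLaplacian` and `Torus.mFourierCoeff_laplacian` for `V`-valued maps,
  Prop. 3.1.2 (8), (10); Thm. 3.3.9) and are the synthesis of their coefficients
  (`IsSmooth.fourierSynth_mFourierCoeff`, Prop. 3.2.5; uniqueness of continuous functions with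
  given coefficients, `Torus.eq_zero_of_forall_mFourierCoeff_eq_zero`, Prop. 3.2.4, reduced to
  Mathlib's scalar `hasSum_mFourier_series_of_summable` by Hahn–Banach; `IsSmooth.ext_mFourierCoeff`).

## Design choices

* Coefficients are indexed by `d → ℤ` as in Mathlib; `|k|² = Torus.freqNormSq k`.
* `fourierSynth` is total (a `tsum`, junk `0` where not summable); all theorems assume
  `RapidDecay`. `V` is a complex normed space, complete where sums are formed.
* Relation to the tree (special cases subsumed, for a later librarian dedupe): the four
  synthesis theorems are those of `TorusLerayHelmholtzProofs` (above); `TorusFourierSeries` proves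
  decay/absolute convergence for smooth real vector fields through `complexify` with the
  anonymous iterate `b ↦ b - (4π²)⁻¹Δb` (here `Torus.oneSubLaplacian`);
  `TorusFourierConvolution` has the `ℂ`-valued `Torus.mFourierCoeff_laplacian_complex` and
  `Torus.eq_of_forall_mFourierCoeff_eq`; `TorusSobolevNormProofs.ae_eq_zero_of_forall_mFourierCoeff_eq_zero`
  is the a.e. uniqueness for complete targets; `FluidPDE/ScalarFourierData` has the `ℂ`-valued
  `mFourierCoeff_laplacian`, `mFourierCoeff_iterate_oneSubLaplacian`; `TorusTrigPoly` treats
  finite sums (`partialDeriv_trigPoly`); `TorusInverseLaplacian` builds `Δ⁻¹` by a kernel. New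
  at this generality (complex Banach `V`): the decay/inversion half and `∂ⱼ` of a synthesis.

## References

* L. Grafakos, *Classical Fourier Analysis*, 3rd ed., GTM 249 (Springer 2014): Prop. 3.1.2
  (7), (8), (10) (PDF p. 188), Prop. 3.2.4 and Prop. 3.2.5 (PDF p. 194), Thm. 3.3.9 (PDF p. 204),
  Def. 3.3.15 (PDF p. 208).
-/

noncomputable section

open Set Filter Function MeasureTheory UnitAddTorus Complex
open scoped Topology ContDiff BigOperators

namespace Literature.Analysis.FunctionSpaces

namespace Torus

variable {d : Type*} [Fintype d]
variable {V : Type*} [NormedAddCommGroup V] [NormedSpace ℂ V]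

/-! ## Rapidly decaying coefficient families -/

section RapidDecay

/-- **Rapid decay** of a family of Fourier coefficients `c : ℤ^d → V`:
`∑_k (1 + |k|²)^m ‖c k‖ < ∞` for every `m ∈ ℕ` (Grafakos 2014, Thm. 3.3.9: the coefficients of a
smooth function decay faster than any polynomial; §3.3.3, Def. 3.3.15: absolutely convergent
Fourier series). [folklore] -/
def RapidDecay (c : (d → ℤ) → V) : Prop :=
  ∀ m : ℕ, Summable fun k => (1 + freqNormSq k) ^ m * ‖c k‖

variable {c c' : (d → ℤ) → V}

/-- `1 ≤ 1 + |k|²`. [folklore] -/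
theorem one_le_one_add_freqNormSq (k : d → ℤ) : (1 : ℝ) ≤ 1 + freqNormSq k := by
  linarith [freqNormSq_nonneg k]

omit [NormedSpace ℂ V] in
/-- Rapidly decaying families are absolutely summable. [folklore] -/
theorem RapidDecay.summable_norm (hc : RapidDecay c) : Summable fun k => ‖c k‖ := by
  simpa using hc 0

omit [NormedSpace ℂ V] in
/-- Rapidly decaying families are summable (in a complete space). [folklore] -/
theorem RapidDecay.summable [CompleteSpace V] (hc : RapidDecay c) : Summable c :=
  hc.summable_norm.of_norm

omit [NormedSpace ℂ V] in
/-- The zero family decays rapidly. [folklore] -/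
theorem rapidDecay_zero : RapidDecay (0 : (d → ℤ) → V) := fun m => by
  simp

omit [NormedSpace ℂ V] in
/-- `0 ≤ (1 + |k|²)^m`. [folklore] -/
theorem one_add_freqNormSq_pow_nonneg (k : d → ℤ) (m : ℕ) : (0 : ℝ) ≤ (1 + freqNormSq k) ^ m :=
  pow_nonneg (zero_le_one.trans (one_le_one_add_freqNormSq k)) m

omit [NormedSpace ℂ V] in
/-- Domination: if `‖c' k‖ ≤ C (1 + |k|²)^s ‖c k‖` for all `k` (a symbol of polynomial growth),
then rapid decay of `c` implies rapid decay of `c'`. [folklore] -/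
theorem RapidDecay.of_norm_le_mul_pow (hc : RapidDecay c) {C : ℝ} {s : ℕ}
    (h : ∀ k, ‖c' k‖ ≤ C * (1 + freqNormSq k) ^ s * ‖c k‖) : RapidDecay c' := by
  intro m
  have hC : ∀ k, 0 ≤ C * (1 + freqNormSq k) ^ s * ‖c k‖ := fun k => (norm_nonneg _).trans (h k)
  refine Summable.of_nonneg_of_le
    (fun k => mul_nonneg (one_add_freqNormSq_pow_nonneg k m) (norm_nonneg _))
    (fun k => mul_le_mul_of_nonneg_left (h k) (one_add_freqNormSq_pow_nonneg k m)) ?_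
  have := (hc (m + s)).mul_left |C|
  refine Summable.of_nonneg_of_le
    (fun k => mul_nonneg (one_add_freqNormSq_pow_nonneg k m) (hC k)) (fun k => ?_) this
  calc (1 + freqNormSq k) ^ m * (C * (1 + freqNormSq k) ^ s * ‖c k‖)
      = C * ((1 + freqNormSq k) ^ (m + s) * ‖c k‖) := by rw [pow_add]; ring
    _ ≤ |C| * ((1 + freqNormSq k) ^ (m + s) * ‖c k‖) :=
        mul_le_mul_of_nonneg_right (le_abs_self C)
          (mul_nonneg (one_add_freqNormSq_pow_nonneg k _) (norm_nonneg _))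

omit [NormedSpace ℂ V] in
/-- Domination with a constant: `‖c' k‖ ≤ C ‖c k‖`. [folklore] -/
theorem RapidDecay.of_norm_le_mul (hc : RapidDecay c) {C : ℝ} (h : ∀ k, ‖c' k‖ ≤ C * ‖c k‖) :
    RapidDecay c' :=
  hc.of_norm_le_mul_pow (s := 0) (C := C) fun k => by rw [pow_zero, mul_one]; exact h k

omit [NormedSpace ℂ V] in
/-- Sums of rapidly decaying families decay rapidly. [folklore] -/
theorem RapidDecay.add (hc : RapidDecay c) (hc' : RapidDecay c') : RapidDecay (c + c') := by
  intro m
  refine Summable.of_nonneg_of_le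
    (fun k => mul_nonneg (one_add_freqNormSq_pow_nonneg k m) (norm_nonneg _))
    (fun k => ?_) ((hc m).add (hc' m))
  rw [Pi.add_apply, ← mul_add]
  exact mul_le_mul_of_nonneg_left (norm_add_le _ _) (one_add_freqNormSq_pow_nonneg k m)

/-- Scalar multiples of rapidly decaying families decay rapidly. [folklore] -/
theorem RapidDecay.const_smul (hc : RapidDecay c) (a : ℂ) : RapidDecay (a • c) :=
  hc.of_norm_le_mul (C := ‖a‖) fun k => by simp [norm_smul]

omit [Fintype d] in
/-- `|kⱼ| ≤ kⱼ² + 1` for an integer `kⱼ`. [folklore] -/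
theorem abs_intCast_le_sq_add_one (n : ℤ) : |(n : ℝ)| ≤ (n : ℝ) ^ 2 + 1 := by
  rcases le_or_gt 1 |(n : ℝ)| with h | h
  · calc |(n : ℝ)| = |(n : ℝ)| * 1 := (mul_one _).symm
      _ ≤ |(n : ℝ)| * |(n : ℝ)| := mul_le_mul_of_nonneg_left h (abs_nonneg _)
      _ = (n : ℝ) ^ 2 := by rw [← sq, sq_abs]
      _ ≤ (n : ℝ) ^ 2 + 1 := by linarith
  · have : (0 : ℝ) ≤ (n : ℝ) ^ 2 := sq_nonneg _
    linarith

/-- Multiplication by the symbol of a first-order derivative: `|kⱼ| ≤ 1 + |k|²`, so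
`k ↦ (2πi kⱼ) • c k` decays rapidly with `c`. [folklore] -/
theorem abs_apply_le_one_add_freqNormSq (k : d → ℤ) (j : d) :
    |(k j : ℝ)| ≤ 1 + freqNormSq k := by
  have h1 := abs_intCast_le_sq_add_one (k j)
  have h2 : (k j : ℝ) ^ 2 ≤ freqNormSq k :=
    Finset.single_le_sum (f := fun i => ((k i : ℝ)) ^ 2) (fun i _ => sq_nonneg _)
      (Finset.mem_univ j)
  linarith

/-- The family `(2πi kⱼ) • c k` of coefficients of `∂ⱼ` decays rapidly with `c`. [folklore] -/
theorem RapidDecay.deriv (hc : RapidDecay c) (j : d) :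
    RapidDecay fun k => (2 * Real.pi * Complex.I * (k j)) • c k := by
  refine hc.of_norm_le_mul_pow (C := 2 * Real.pi) (s := 1) fun k => ?_
  rw [norm_smul, pow_one]
  have hn : ‖(2 * Real.pi * Complex.I * (k j) : ℂ)‖ = 2 * Real.pi * |(k j : ℝ)| := by
    simp [abs_of_pos Real.pi_pos]
  rw [hn]
  have h1 : 2 * Real.pi * |(k j : ℝ)| ≤ 2 * Real.pi * (1 + freqNormSq k) :=
    mul_le_mul_of_nonneg_left (abs_apply_le_one_add_freqNormSq k j) (by positivity)
  exact mul_le_mul_of_nonneg_right h1 (norm_nonneg _)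

end RapidDecay

/-! ## Fourier synthesis of rapidly decaying families -/

section Synthesis

/-- `‖e_k(x) • v‖ = ‖v‖`. [folklore] -/
theorem norm_mFourier_smul (k : d → ℤ) (x : UnitAddTorus d) (v : V) :
    ‖mFourier k x • v‖ = ‖v‖ := by
  rw [norm_smul, norm_mFourier_apply, one_mul]

variable [CompleteSpace V]

/-- **Fourier synthesis**: the sum `F_c(x) = ∑_k e_k(x) c_k` of the Fourier series with
coefficients `c : ℤ^d → V` (`tsum`; meaningful for absolutely summable `c`, in particular for
rapidly decaying `c`) (Grafakos 2014, Prop. 3.2.5: Fourier inversion for absolutely summable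
coefficients). [folklore] -/
def fourierSynth (c : (d → ℤ) → V) : UnitAddTorus d → V :=
  fun x => ∑' k, mFourier k x • c k

variable {c : (d → ℤ) → V}

/-- The Fourier series of a rapidly decaying family converges (absolutely) to its synthesis
(`Torus.hasSum_mFourier_smul` of `TorusLerayHelmholtzProofs`, which needs only `∑ ‖c k‖ < ∞`).
[folklore] -/
theorem RapidDecay.hasSum_fourierSynth (hc : RapidDecay c) (x : UnitAddTorus d) :
    HasSum (fun k => mFourier k x • c k) (fourierSynth c x) :=
  hasSum_mFourier_smul hc.summable_norm x

/-- **Smoothness of the synthesis**: for rapidly decaying `c`, `F_c ∈ C^∞(T^d)` — this is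
`Torus.isSmooth_tsum_mFourier_smul` of `TorusLerayHelmholtzProofs` (termwise differentiation with
the bounds `‖Dᵐ(e_k ∘ proj)‖ ≤ (2π(1 + |k|²))ᵐ`, Grafakos 2014, Prop. 3.3.12), restated for the
named predicate and operator. [folklore] -/
theorem RapidDecay.isSmooth_fourierSynth (hc : RapidDecay c) : IsSmooth (fourierSynth c) :=
  isSmooth_tsum_mFourier_smul hc

/-- The synthesis of a rapidly decaying family is continuous
(`Torus.continuous_tsum_mFourier_smul`). [folklore] -/
theorem RapidDecay.continuous_fourierSynth (hc : RapidDecay c) : Continuous (fourierSynth c) :=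
  continuous_tsum_mFourier_smul hc.summable_norm

/-- **The Fourier coefficients of the synthesis are the given coefficients**,
`𝓕(F_c)(m) = c m` (`Torus.mFourierCoeff_tsum_mFourier_smul` of `TorusLerayHelmholtzProofs`:
termwise integration and orthonormality of the characters, Grafakos 2014, §3.1.1). [folklore] -/
theorem RapidDecay.mFourierCoeff_fourierSynth (hc : RapidDecay c) (m : d → ℤ) :
    mFourierCoeff (fourierSynth c) m = c m :=
  mFourierCoeff_tsum_mFourier_smul hc.summable_norm m

/-- Along a coordinate line the character factorises: `e_k(x + t eⱼ) = e_k(x) e^{2πi kⱼ t}`.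
[folklore] -/
theorem mFourier_add_proj_smul_single [DecidableEq d] (k : d → ℤ) (x : UnitAddTorus d) (j : d)
    (t : ℝ) :
    mFourier k (x + proj (t • EuclideanSpace.single j (1 : ℝ))) =
      mFourier k x * fourier (k j) (t : UnitAddCircle) := by
  rw [mFourier_apply_add, mFourier_proj_smul_single]

/-- **Partial derivatives of the synthesis act diagonally**: for rapidly decaying `c`,
`∂ⱼ F_c = F_{(2πi kⱼ) c}` (termwise differentiation, Mathlib's `hasDerivAt_tsum`, of the series
along the coordinate line) (Grafakos 2014, Prop. 3.1.2 (10)). [folklore] -/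
theorem RapidDecay.partialDeriv_fourierSynth [DecidableEq d] (hc : RapidDecay c) (j : d)
    (x : UnitAddTorus d) :
    partialDeriv j (fourierSynth c) x =
      fourierSynth (fun k => (2 * Real.pi * Complex.I * (k j)) • c k) x := by
  -- the terms along the line and their derivatives
  set g : (d → ℤ) → ℝ → V := fun k t =>
    mFourier k (x + proj (t • EuclideanSpace.single j (1 : ℝ))) • c k with hg
  set g' : (d → ℤ) → ℝ → V := fun k t =>
    (mFourier k x * (2 * Real.pi * Complex.I * (k j) * fourier (k j) (t : UnitAddCircle))) • c k
    with hg'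
  have hderiv : ∀ k t, HasDerivAt (g k) (g' k t) t := by
    intro k t
    have h := ((hasDerivAt_fourier 1 (k j) t).const_mul (mFourier k x)).smul_const (c k)
    simp only [Complex.ofReal_one, div_one] at h
    have hfun : g k = fun t : ℝ => (mFourier k x * fourier (k j) (t : UnitAddCircle)) • c k := by
      funext t
      simp only [hg, mFourier_add_proj_smul_single]
    rw [hfun]
    exact h
  have hbound : ∀ k t, ‖g' k t‖ ≤ ‖(2 * Real.pi * Complex.I * (k j)) • c k‖ := by
    intro k t
    simp only [hg', norm_smul, norm_mul, norm_mFourier_apply, one_mul]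
    have h1 : ‖(fourier (k j)) (t : UnitAddCircle)‖ = 1 := by
      rw [fourier_apply, Circle.norm_coe]
    rw [h1, mul_one]
  have hu : Summable fun k => ‖(2 * Real.pi * Complex.I * (k j)) • c k‖ :=
    (hc.deriv j).summable_norm
  have h0 : Summable fun k => g k 0 :=
    Summable.of_norm_bounded hc.summable_norm fun k => (norm_mFourier_smul _ _ _).le
  have H := hasDerivAt_tsum hu hderiv hbound h0 0
  -- identify both sides
  rw [partialDeriv, Torus.lineDeriv]
  change _root_.deriv
    (fun t : ℝ => fourierSynth c (x + proj (t • EuclideanSpace.single j (1 : ℝ)))) 0 = _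
  have hF : (fun t : ℝ => fourierSynth c (x + proj (t • EuclideanSpace.single j (1 : ℝ)))) =
      fun t => ∑' k, g k t := by
    funext t
    rfl
  rw [hF, H.deriv, fourierSynth]
  congr 1
  funext k
  simp only [hg', QuotientAddGroup.mk_zero, fourier_eval_zero, mul_one, smul_smul]

/-- All partial derivatives of the synthesis of a rapidly decaying family are again syntheses of
rapidly decaying families; in particular they are smooth. [folklore] -/
theorem RapidDecay.partialDeriv_fourierSynth_eq [DecidableEq d] (hc : RapidDecay c) (j : d) :
    partialDeriv j (fourierSynth c) =
      fourierSynth (fun k => (2 * Real.pi * Complex.I * (k j)) • c k) :=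
  funext (hc.partialDeriv_fourierSynth j)

end Synthesis

/-! ## Smooth functions: decay of the coefficients and Fourier inversion -/

section SmoothDecay

variable [DecidableEq d]

/-- **Fourier coefficients of the Laplacian**: `𝓕(Δg)(k) = -4π²|k|² 𝓕g(k)` for smooth
`V`-valued `g` (Grafakos 2014, Prop. 3.1.2 (10), `𝓕(∂^α f)(m) = (2πi m)^α 𝓕f(m)`, `|α| = 2`;
the `ℂ`-valued cases are `Torus.mFourierCoeff_laplacian_complex` of `TorusFourierConvolution` and
`ScalarFourier.mFourierCoeff_laplacian` of `FluidPDE/ScalarFourierData`, the complexified real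
case `Torus.mFourierCoeff_complexify_laplacian`). [cite: Grafakos2014, Prop. 3.1.2 (10)] -/
theorem mFourierCoeff_laplacian {g : UnitAddTorus d → V} (hg : IsSmooth g) (k : d → ℤ) :
    mFourierCoeff (laplacian g) k =
      -(((4 * Real.pi ^ 2 * freqNormSq k : ℝ) : ℂ) • mFourierCoeff g k) := by
  have hfun : laplacian g = fun x => ∑ i, partialDeriv i (partialDeriv i g) x :=
    funext (laplacian_eq_sum_partialDeriv_partialDeriv hg)
  rw [hfun, mFourierCoeff_finset_sum _ fun i _ => ((hg.partialDeriv i).partialDeriv i).integrable]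
  simp_rw [mFourierCoeff_partialDeriv (hg.partialDeriv _), mFourierCoeff_partialDeriv hg, smul_smul,
    ← Finset.sum_smul, ← neg_smul]
  congr 1
  rw [freqNormSq]
  push_cast
  rw [Finset.mul_sum, ← Finset.sum_neg_distrib]
  refine Finset.sum_congr rfl fun i _ => ?_
  linear_combination ((2 : ℂ) * Real.pi * (k i : ℂ)) ^ 2 * Complex.I_mul_I

/-- The elliptic operator `g ↦ g - (4π²)⁻¹ Δg` (whose Fourier multiplier is `1 + |k|²`).
[folklore] -/
def oneSubLaplacian (g : UnitAddTorus d → V) : UnitAddTorus d → V :=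
  fun x => g x - ((4 * Real.pi ^ 2)⁻¹ : ℂ) • laplacian g x

omit [DecidableEq d] in
/-- `1 - (4π²)⁻¹Δ` preserves smoothness. [folklore] -/
theorem IsSmooth.oneSubLaplacian {g : UnitAddTorus d → V} (hg : IsSmooth g) :
    IsSmooth (Torus.oneSubLaplacian g) :=
  ContDiff.sub hg (ContDiff.const_smul ((4 * Real.pi ^ 2)⁻¹ : ℂ) hg.laplacian)

omit [DecidableEq d] in
/-- Iterates of `1 - (4π²)⁻¹Δ` preserve smoothness. [folklore] -/
theorem IsSmooth.iterate_oneSubLaplacian {g : UnitAddTorus d → V} (hg : IsSmooth g) (m : ℕ) :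
    IsSmooth (Torus.oneSubLaplacian^[m] g) := by
  induction m generalizing g with
  | zero => exact hg
  | succ m ih =>
    rw [Function.iterate_succ_apply]
    exact ih hg.oneSubLaplacian

/-- `𝓕((1 - (4π²)⁻¹Δ) g)(k) = (1 + |k|²) 𝓕g(k)` for smooth `g`. [cite: Grafakos2014, Prop. 3.1.2 (10)] -/
theorem mFourierCoeff_oneSubLaplacian {g : UnitAddTorus d → V} (hg : IsSmooth g) (k : d → ℤ) :
    mFourierCoeff (oneSubLaplacian g) k = ((1 + freqNormSq k : ℝ) : ℂ) • mFourierCoeff g k := by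
  have h1 : mFourierCoeff (oneSubLaplacian g) k =
      mFourierCoeff g k - ((4 * Real.pi ^ 2)⁻¹ : ℂ) • mFourierCoeff (laplacian g) k := by
    rw [show oneSubLaplacian g = g - ((4 * Real.pi ^ 2)⁻¹ : ℂ) • laplacian g from rfl,
      mFourierCoeff_sub hg.integrable (hg.laplacian.integrable.smul _), mFourierCoeff_const_smul]
  rw [h1, mFourierCoeff_laplacian hg, smul_neg, sub_neg_eq_add, smul_smul]
  have hπ : (Real.pi : ℂ) ≠ 0 := by exact_mod_cast Real.pi_ne_zero
  rw [show mFourierCoeff g k + (((4 * Real.pi ^ 2)⁻¹ : ℂ) * ((4 * Real.pi ^ 2 * freqNormSq k : ℝ) : ℂ)) •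
      mFourierCoeff g k = ((1 + freqNormSq k : ℝ) : ℂ) • mFourierCoeff g k by
    push_cast
    rw [add_smul, one_smul]
    congr 1
    field_simp]

/-- `𝓕((1 - (4π²)⁻¹Δ)^m g)(k) = (1 + |k|²)^m 𝓕g(k)` for smooth `g` (the `ℂ`-valued case
is `ScalarFourier.mFourierCoeff_iterate_oneSubLaplacian`, the complexified real-vector case
`Torus.mFourierCoeff_complexify_iterate_oneSubLaplacian`). [cite: Grafakos2014, Prop. 3.1.2 (10)] -/
theorem mFourierCoeff_iterate_oneSubLaplacian {g : UnitAddTorus d → V} (hg : IsSmooth g) (m : ℕ)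
    (k : d → ℤ) :
    mFourierCoeff (oneSubLaplacian^[m] g) k = (((1 + freqNormSq k) ^ m : ℝ) : ℂ) • mFourierCoeff g k := by
  induction m generalizing g with
  | zero => simp
  | succ m ih =>
    rw [Function.iterate_succ_apply, ih hg.oneSubLaplacian, mFourierCoeff_oneSubLaplacian hg,
      smul_smul]
    congr 1
    push_cast
    ring

variable [CompleteSpace V]

/-- **Decay of the Fourier coefficients of smooth functions**:
`(1 + |k|²)^m ‖𝓕g(k)‖ ≤ sup ‖(1 - (4π²)⁻¹Δ)^m g‖` (Grafakos 2014, Prop. 3.1.2 (8), (10); cf. Thm. 3.3.9 (a)).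
[cite: Grafakos2014, Prop. 3.1.2 (8)] -/
theorem norm_mFourierCoeff_mul_pow_le {g : UnitAddTorus d → V} (hg : IsSmooth g) {m : ℕ} {K : ℝ}
    (hK : ∀ x, ‖(oneSubLaplacian^[m] g) x‖ ≤ K) (k : d → ℤ) :
    (1 + freqNormSq k) ^ m * ‖mFourierCoeff g k‖ ≤ K := by
  have h := norm_mFourierCoeff_le_of_forall_norm_le hK k
  rwa [mFourierCoeff_iterate_oneSubLaplacian hg m k, norm_smul, Complex.norm_real, Real.norm_eq_abs,
    abs_of_nonneg (one_add_freqNormSq_pow_nonneg k m)] at h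

/-- **Smooth functions have rapidly decaying Fourier coefficients** (Grafakos 2014, Thm. 3.3.9
(a): smoothness of order `s` gives `|𝓕f(m)|(1 + |m|^s) → 0`; here quantitatively
`∑_k (1 + |k|²)^m ‖𝓕g(k)‖ ≤ sup ‖(1 - (4π²)⁻¹Δ)^{m + #d} g‖ · ∑_k (1 + |k|²)^{-#d} < ∞`).
[cite: Grafakos2014, Thm. 3.3.9] -/
theorem IsSmooth.rapidDecay_mFourierCoeff {g : UnitAddTorus d → V} (hg : IsSmooth g) :
    RapidDecay (mFourierCoeff g) := by
  intro m
  obtain ⟨K, hK⟩ := isCompact_univ.exists_bound_of_continuousOn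
    (hg.iterate_oneSubLaplacian (m + Fintype.card d)).continuous.continuousOn
  have hK' : ∀ x, ‖(Torus.oneSubLaplacian^[m + Fintype.card d] g) x‖ ≤ K := fun x =>
    hK x (mem_univ x)
  refine Summable.of_nonneg_of_le
    (fun k => mul_nonneg (one_add_freqNormSq_pow_nonneg k m) (norm_nonneg _)) (fun k => ?_)
    (summable_inv_one_add_freqNormSq_pow_card.mul_left K)
  have hpos : 0 < (1 + freqNormSq k) ^ Fintype.card d :=
    pow_pos (zero_lt_one.trans_le (one_le_one_add_freqNormSq k)) _
  have h := norm_mFourierCoeff_mul_pow_le hg hK' k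
  rw [pow_add] at h
  rw [le_mul_inv_iff₀ hpos]
  calc (1 + freqNormSq k) ^ m * ‖mFourierCoeff g k‖ * (1 + freqNormSq k) ^ Fintype.card d
      = (1 + freqNormSq k) ^ m * (1 + freqNormSq k) ^ Fintype.card d * ‖mFourierCoeff g k‖ := by
        ring
    _ ≤ K := h

omit [DecidableEq d] in
/-- A continuous function all of whose Fourier coefficients vanish is zero (scalar case:
Mathlib's uniform convergence of the Fourier series with summable — here zero — coefficients;
vector case by Hahn–Banach) (Grafakos 2014, Prop. 3.2.4: the coefficients determine an `L¹`
function a.e.; the `ℂ`-valued continuous case is `Torus.eq_of_forall_mFourierCoeff_eq` of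
`TorusFourierConvolution`, the a.e. version for complete targets is
`Torus.ae_eq_zero_of_forall_mFourierCoeff_eq_zero` of `TorusSobolevNormProofs`).
[cite: Grafakos2014, Prop. 3.2.4] -/
theorem eq_zero_of_forall_mFourierCoeff_eq_zero {h : UnitAddTorus d → V} (hh : Continuous h)
    (h0 : ∀ k, mFourierCoeff h k = 0) : h = 0 := by
  funext x
  refine SeparatingDual.eq_zero_of_forall_dual_eq_zero (R := ℂ) fun φ => ?_
  -- the scalar function `φ ∘ h`
  set F : C(UnitAddTorus d, ℂ) := ⟨fun x => φ (h x), φ.continuous.comp hh⟩ with hF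
  have hcoeff : ∀ k, mFourierCoeff F k = 0 := by
    intro k
    have : mFourierCoeff (fun x => φ (h x)) k = φ (mFourierCoeff h k) := by
      simp only [mFourierCoeff_eq_integral_volume]
      rw [← ContinuousLinearMap.integral_comp_comm φ (integrable_mFourier_smul_of_continuous hh k)]
      congr 1
      funext x
      rw [map_smul]
    change mFourierCoeff (fun x => φ (h x)) k = 0
    rw [this, h0 k, map_zero]
  have hsum : Summable (mFourierCoeff F) :=
    (summable_zero (β := d → ℤ) (α := ℂ)).congr fun k => (hcoeff k).symm
  have H := hasSum_mFourier_series_apply_of_summable hsum x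
  have hzero : (fun i => mFourierCoeff F i • mFourier i x) = fun _ => 0 := by
    funext i
    rw [hcoeff i, zero_smul]
  rw [hzero] at H
  have : F x = 0 := (hasSum_zero.unique H).symm
  simpa [hF] using this

/-- **Fourier inversion for smooth functions**: a smooth `V`-valued function on `T^d` is the
synthesis of its (rapidly decaying) Fourier coefficients, `g = ∑_k e_k • 𝓕g(k)`
(Grafakos 2014, Prop. 3.2.5: Fourier inversion for absolutely summable coefficients).
[cite: Grafakos2014, Prop. 3.2.5] -/
theorem IsSmooth.fourierSynth_mFourierCoeff {g : UnitAddTorus d → V} (hg : IsSmooth g) :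
    fourierSynth (mFourierCoeff g) = g := by
  have hc := hg.rapidDecay_mFourierCoeff
  have hdiff : (fun x => fourierSynth (mFourierCoeff g) x - g x) = 0 := by
    refine eq_zero_of_forall_mFourierCoeff_eq_zero (hc.continuous_fourierSynth.sub hg.continuous)
      fun k => ?_
    rw [show (fun x => fourierSynth (mFourierCoeff g) x - g x) = fourierSynth (mFourierCoeff g) - g
        from rfl, mFourierCoeff_sub hc.continuous_fourierSynth.integrable_unitAddTorus hg.integrable,
      hc.mFourierCoeff_fourierSynth, sub_self]
  funext x
  have := congrFun hdiff x
  simpa [sub_eq_zero] using this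

/-- Two smooth functions with the same Fourier coefficients coincide. [cite: Grafakos2014, Prop. 3.2.4] -/
theorem IsSmooth.ext_mFourierCoeff {g g' : UnitAddTorus d → V} (hg : IsSmooth g) (hg' : IsSmooth g')
    (h : ∀ k, mFourierCoeff g k = mFourierCoeff g' k) : g = g' := by
  rw [← hg.fourierSynth_mFourierCoeff, ← hg'.fourierSynth_mFourierCoeff]
  congr 1
  funext k
  exact h k

end SmoothDecay

end Torus

end Literature.Analysis.FunctionSpaces
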